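import Mathlib
import HarnessLib
import Summits.HubbardSuperconductivity.HubbardSuperconductivity.Theorems.KLProgrammeKLRegimeVolumeLimitFlowFramesJets
import Summits.HubbardSuperconductivity.HubbardSuperconductivity.Theorems.KLProgrammeKLRegimeEngineFlowPieceIncrementData

/-!
# Route `KLProgramme` — crux K3, VL child `KLRegimeVolumeLimitV17F2` (stmt-HubbardSuperconductivity-20440), blueprint v4 M2 «MISMATCH-SLICE»:
# THE TWO-VOLUME TOP-FRAME MISMATCH AS AN INCREMENT PIECE — the piece data `hv₀ … hv₃` and the base band data `hb₁ … hb₃` of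
# `TorusFourierL2.sliceIncrPairWt_charSum_l1_le` for the pair of flow frames `(K_n^{(L,M)}, K_n^{(L″,M″)})`, from the V17F2 tower
# (cell gate-hubbard-kl, seat hubbard-kl-k3c5-p3 g11, technique «OS-positivity-free direct assembly»; pen (R75a))

ASK 1 «MISMATCH-SLICE» (k3c4-p1 blueprint v4 §3, M2): per scale `j ≤ n⋆` on the fine volume, rows / entries of the sector-pulled-back slice covariance
DIFFERENCE `S(F̃_j)ᵀ·(C^{K}_{(Λ_j,Λ_{j−1}]} − C^{K″}_{(Λ_j,Λ_{j−1}]})·S(F̃_j)` between the two volumes' flow frames `K = K_n^{(L,M)}`, `K″ = K_n^{(L″,M″)}`.  This is ONE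
INSTANCE of the tree's frame-INCREMENT chain (k3c3-p2 g8/g9, written for two ARBITRARY frames `K, K′`): the per-pair weighted `ℓ¹` bound
`TorusFourierL2.sliceIncrPairWt_charSum_l1_le` (symbol `ŝ^{K′} − ŝ^{K}`; inputs: band data of `K`, PIECE data `P₀ … P₃` of `e_{K′} − e_K`, cutoff and
multiplier data, rates) and the rows lemmas of `…SectorSliceRowsMomentGeneric` / `…SectorSliceRowsTelescope`; weighted rows dominate unweighted rows
(weight `≥ 1`) and entries.  The only TWO-VOLUME input of that instance is the piece: here it is, from the tower alone.

* **`twoVolume_frameMismatch_piece_data`** — under `TowerP klPredsV17F2 …` (`μ ∈ klWindowC`), for `Lstar ≤ L ≤ L″`, admissible cutoffs and `n ≤ n_β + 1`: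
  `|e_{K″} − e_K| ≤ c₀(n)/L`, `‖D(e_{K″} − e_K)‖ ≤ c₁(n)/L`, `‖D²(…)‖ ≤ c₂(n)/L`, `‖D³(…)‖ ≤ c₃(n)/L` on `Momentum`, in EXACTLY the `hv₀ … hv₃` shapes of the
  increment pair lemma, `c_i(n) = Σ_{m<n} 4(2d_m+1)(1+4d_m)^i·Q.CL β m` (`…FlowFramesJets.norm_iteratedFDeriv_sub_evalM_klFlowFrameU_le_of_towerV17F2`;
  `e_K = e_0 − evalM K`);  `twoVolume_frameMismatch_piece_data'` — the opposite orientation (`e_K − e_{K″}`, same bounds);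
* **`flowFrame_band_data_of_towerV17F2`** — the base band data `‖De_{K_n}‖ ≤ 4 + Σ_{m<n} Gfr₁·uPow 1 U·4^{−m}`, `‖D²e_{K_n}‖ ≤ 16 + Σ Gfr₂·uPow 2 U`,
  `‖D³e_{K_n}‖ ≤ 64 + Σ Gfr₃·uPow 3 U·4^{m}` of EITHER volume's flow frame, from the tower's (I-F jets) (`EngineV8.flowFrame_band_data`).
So every `P_i` of the mismatch instance is `O(1/L)` with an `L`-free numerator, and the instance's amplitude `A₀ ∝ P₀ ∝ 1/L`: the mismatch rows vanish as
`L → ∞` at every fixed scale.  Proofs only; no definition; nothing asserts superconductivity.  References: BGM 2006 §3 (3.2)–(3.8); FST 1996 §1.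
-/

noncomputable section

namespace Summit.HubbardSuperconductivity.HubbardSuperconductivity.Theorems.TwoPointAssembly

set_option linter.dupNamespace false -- summit = problem name (single-conjunct summit), D-0017

open Real Finset Filter Topology Literature.MathematicalPhysics.QuantumLattice Literature.Probability.LatticeModels
open Summit.HubbardSuperconductivity.HubbardSuperconductivity.Theorems.DispersionFlow
open Summit.HubbardSuperconductivity.HubbardSuperconductivity.Theorems.KLRegimeSplit
open Summit.HubbardSuperconductivity.HubbardSuperconductivity.Theorems.KLProgrammeLegKernels
open Summit.HubbardSuperconductivity.HubbardSuperconductivity.Theorems.EngineV8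

section Tower

variable {G : GeoConsts} {P : SplitConsts} {Q : EngConsts} {R : RenConsts} {β U μ : ℝ} {K₀ : TrigPolyC4v} {Lstar : ℕ} {Mstar : ℕ → ℕ}

/-- `e_{K″} − e_K = evalM K − evalM K″` as functions on `Momentum` (`e_K = e_0 − evalM K`). [cite: FeldmanSalmhoferTrubowitz1996, §1] -/
theorem frameLevel_sub_frameLevel_eq (μ : ℝ) (K K'' : TrigPolyC4v) :
    (fun q : Momentum => frameLevel μ K'' q - frameLevel μ K q) = fun q : Momentum => evalM K q - evalM K'' q := by
  funext q
  rw [frameLevel_eq_zero_sub_evalM μ K'', frameLevel_eq_zero_sub_evalM μ K]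
  ring

/-- **THE TWO-VOLUME TOP-FRAME MISMATCH AS AN INCREMENT PIECE** (orientation `e_{K″} − e_K`, `K = K_n^{(L,M)}`, `K″ = K_n^{(L″,M″)}`): the four piece
hypotheses `hv₀ … hv₃` of `TorusFourierL2.sliceIncrPairWt_charSum_l1_le` with `P_i = c_i(n)/L`. [cite: BenfattoGiulianiMastropietro2006, §3 (3.2)-(3.8)] -/
theorem twoVolume_frameMismatch_piece_data (hμ : μ ∈ klWindowC) (hT : TowerP klPredsV17F2 G P Q R β U μ K₀ Lstar Mstar)
    {L : ℕ} [NeZero L] (hL : Lstar ≤ L) {L'' : ℕ} [NeZero L''] (hLL'' : L ≤ L'')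
    {M : ℕ} [NeZero M] (hM₁ : Mstar L ≤ M) (hM₂ : Q.M0 β L ≤ M) {M'' : ℕ} [NeZero M''] (hM''₁ : Mstar L'' ≤ M'') (hM''₂ : Q.M0 β L'' ≤ M'')
    {n : ℕ} (hn : n ≤ nScales β + 1) :
    (∀ p : Momentum, |frameLevel μ (klFlowFrameU L'' M'' β U μ n) p - frameLevel μ (klFlowFrameU L M β U μ n) p| ≤
        (∑ m ∈ range n, 4 * (2 * klFlowDeg m + 1) * (1 + 4 * klFlowDeg m) ^ (0 : ℕ) * Q.CL β m) / L) ∧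
    (∀ p : Momentum, ‖fderiv ℝ (fun q : Momentum => frameLevel μ (klFlowFrameU L'' M'' β U μ n) q - frameLevel μ (klFlowFrameU L M β U μ n) q) p‖ ≤
        (∑ m ∈ range n, 4 * (2 * klFlowDeg m + 1) * (1 + 4 * klFlowDeg m) ^ (1 : ℕ) * Q.CL β m) / L) ∧
    (∀ p : Momentum, ‖iteratedFDeriv ℝ 2
        (fun q : Momentum => frameLevel μ (klFlowFrameU L'' M'' β U μ n) q - frameLevel μ (klFlowFrameU L M β U μ n) q) p‖ ≤
        (∑ m ∈ range n, 4 * (2 * klFlowDeg m + 1) * (1 + 4 * klFlowDeg m) ^ (2 : ℕ) * Q.CL β m) / L) ∧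
    (∀ p : Momentum, ‖iteratedFDeriv ℝ 3
        (fun q : Momentum => frameLevel μ (klFlowFrameU L'' M'' β U μ n) q - frameLevel μ (klFlowFrameU L M β U μ n) q) p‖ ≤
        (∑ m ∈ range n, 4 * (2 * klFlowDeg m + 1) * (1 + 4 * klFlowDeg m) ^ (3 : ℕ) * Q.CL β m) / L) := by
  have hF := frameLevel_sub_frameLevel_eq μ (klFlowFrameU L M β U μ n) (klFlowFrameU L'' M'' β U μ n)
  have hD := fun j p => norm_iteratedFDeriv_sub_evalM_klFlowFrameU_le_of_towerV17F2 hμ hT hL hLL'' hM₁ hM₂ hM''₁ hM''₂ hn j p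
  refine ⟨fun p => ?_, fun p => ?_, fun p => ?_, fun p => ?_⟩
  · have h := hD 0 p
    rw [norm_iteratedFDeriv_zero, Real.norm_eq_abs] at h
    have e := congrFun hF p
    rw [e]; exact h
  · have h := hD 1 p
    rw [norm_iteratedFDeriv_one] at h
    rw [hF]; exact h
  · rw [hF]; exact hD 2 p
  · rw [hF]; exact hD 3 p

/-- **The opposite orientation** `e_K − e_{K″}` (same bounds: a derivative of the negative has the same norm). [cite: BenfattoGiulianiMastropietro2006, §3 (3.2)-(3.8)] -/
theorem twoVolume_frameMismatch_piece_data' (hμ : μ ∈ klWindowC) (hT : TowerP klPredsV17F2 G P Q R β U μ K₀ Lstar Mstar)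
    {L : ℕ} [NeZero L] (hL : Lstar ≤ L) {L'' : ℕ} [NeZero L''] (hLL'' : L ≤ L'')
    {M : ℕ} [NeZero M] (hM₁ : Mstar L ≤ M) (hM₂ : Q.M0 β L ≤ M) {M'' : ℕ} [NeZero M''] (hM''₁ : Mstar L'' ≤ M'') (hM''₂ : Q.M0 β L'' ≤ M'')
    {n : ℕ} (hn : n ≤ nScales β + 1) :
    (∀ p : Momentum, |frameLevel μ (klFlowFrameU L M β U μ n) p - frameLevel μ (klFlowFrameU L'' M'' β U μ n) p| ≤
        (∑ m ∈ range n, 4 * (2 * klFlowDeg m + 1) * (1 + 4 * klFlowDeg m) ^ (0 : ℕ) * Q.CL β m) / L) ∧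
    (∀ p : Momentum, ‖fderiv ℝ (fun q : Momentum => frameLevel μ (klFlowFrameU L M β U μ n) q - frameLevel μ (klFlowFrameU L'' M'' β U μ n) q) p‖ ≤
        (∑ m ∈ range n, 4 * (2 * klFlowDeg m + 1) * (1 + 4 * klFlowDeg m) ^ (1 : ℕ) * Q.CL β m) / L) ∧
    (∀ p : Momentum, ‖iteratedFDeriv ℝ 2
        (fun q : Momentum => frameLevel μ (klFlowFrameU L M β U μ n) q - frameLevel μ (klFlowFrameU L'' M'' β U μ n) q) p‖ ≤
        (∑ m ∈ range n, 4 * (2 * klFlowDeg m + 1) * (1 + 4 * klFlowDeg m) ^ (2 : ℕ) * Q.CL β m) / L) ∧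
    (∀ p : Momentum, ‖iteratedFDeriv ℝ 3
        (fun q : Momentum => frameLevel μ (klFlowFrameU L M β U μ n) q - frameLevel μ (klFlowFrameU L'' M'' β U μ n) q) p‖ ≤
        (∑ m ∈ range n, 4 * (2 * klFlowDeg m + 1) * (1 + 4 * klFlowDeg m) ^ (3 : ℕ) * Q.CL β m) / L) := by
  obtain ⟨h0, h1, h2, h3⟩ := twoVolume_frameMismatch_piece_data hμ hT hL hLL'' hM₁ hM₂ hM''₁ hM''₂ hn
  have hneg : (fun q : Momentum => frameLevel μ (klFlowFrameU L M β U μ n) q - frameLevel μ (klFlowFrameU L'' M'' β U μ n) q) =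
      -(fun q : Momentum => frameLevel μ (klFlowFrameU L'' M'' β U μ n) q - frameLevel μ (klFlowFrameU L M β U μ n) q) := by
    funext q; simp only [Pi.neg_apply, neg_sub]
  refine ⟨fun p => ?_, fun p => ?_, fun p => ?_, fun p => ?_⟩
  · rw [abs_sub_comm]; exact h0 p
  · rw [hneg, fderiv_neg, norm_neg]; exact h1 p
  · rw [hneg, iteratedFDeriv_neg_apply, norm_neg]; exact h2 p
  · rw [hneg, iteratedFDeriv_neg_apply, norm_neg]; exact h3 p

/-- **The base band data of a flow frame, from the tower** (either volume): for `Lstar ≤ L`, `Mstar L ≤ M`, `n ≤ n_β + 1`,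
`‖De_{K_n}‖ ≤ 4 + Σ_{m<n} Gfr₁·uPow 1 U·4^{−m}`, `‖D²e_{K_n}‖ ≤ 16 + Σ_{m<n} Gfr₂·uPow 2 U`, `‖D³e_{K_n}‖ ≤ 64 + Σ_{m<n} Gfr₃·uPow 3 U·4^{m}` — the `hb₁ hb₂ hb₃`
of the increment pair lemma (∘ `EngineV8.flowFrame_band_data`, (I-F jets) read off `RenormFlowAtV17F`). [cite: BenfattoGiulianiMastropietro2006, §3 (3.2)-(3.8)] -/
theorem flowFrame_band_data_of_towerV17F2 (hT : TowerP klPredsV17F2 G P Q R β U μ K₀ Lstar Mstar)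
    {L : ℕ} [NeZero L] (hL : Lstar ≤ L) {M : ℕ} [NeZero M] (hM : Mstar L ≤ M) {n : ℕ} (hn : n ≤ nScales β + 1) :
    (∀ p : Momentum, ‖fderiv ℝ (frameLevel μ (klFlowFrameU L M β U μ n)) p‖ ≤
        (4 : ℝ) ^ (1 : ℕ) + ∑ m' ∈ range n, R.Gfr 1 * uPow 1 U * (4 : ℝ) ^ ((((1 : ℕ) : ℤ) - 2) * m')) ∧
    (∀ p : Momentum, ‖iteratedFDeriv ℝ 2 (frameLevel μ (klFlowFrameU L M β U μ n)) p‖ ≤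
        (4 : ℝ) ^ (2 : ℕ) + ∑ m' ∈ range n, R.Gfr 2 * uPow 2 U * (4 : ℝ) ^ ((((2 : ℕ) : ℤ) - 2) * m')) ∧
    (∀ p : Momentum, ‖iteratedFDeriv ℝ 3 (frameLevel μ (klFlowFrameU L M β U μ n)) p‖ ≤
        (4 : ℝ) ^ (3 : ℕ) + ∑ m' ∈ range n, R.Gfr 3 * uPow 3 U * (4 : ℝ) ^ ((((3 : ℕ) : ℤ) - 2) * m')) := by
  have hTL := hT L M hL hM
  have hJ : ∀ m < n, FlowPieceJetsAt L M β U μ R m := by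
    intro m hm
    have hm' : m ≤ nScales β := by omega
    have hren : RenormFlowAtV17F L M β U μ R m := (hTL.1 m hm').1
    exact hren.2.1
  exact flowFrame_band_data hJ

end Tower

end Summit.HubbardSuperconductivity.HubbardSuperconductivity.Theorems.TwoPointAssembly

end
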